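import Mathlib.Analysis.SpecialFunctions.Log.Basic
import Mathlib.FieldTheory.AlgebraicClosure
import Literature.NumberTheory.Transcendental.BakerLogarithmsConclusion

/-!
# Baker's theorem in coefficient form, and for real logarithms

Corollaries of the tree's sorry-free Baker theorem `Literature.NumberTheory.Transcendental.baker_holds`
(Baker 1975, Theorem 2.1: if `e^{lᵢ}` is algebraic for every `i` and the `lᵢ` are linearly
independent over `ℚ`, then `1, l₁, l₂, …` are linearly independent over the field
`ℚ̄ = algebraicClosure ℚ ℂ` of all algebraic numbers), in the shapes in which the theorem is
consumed downstream, over an arbitrary finite index type: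

* `baker_coeff_eq_zero` — the COEFFICIENT form of Theorem 2.1: a relation `β₀ + Σᵢ βᵢ lᵢ = 0` with
  algebraic `β₀, βᵢ ∈ ℂ` has `β₀ = 0` and every `βᵢ = 0` (`baker_holds` read through Mathlib's
  `Fintype.linearIndependent_iff` at the `ℚ̄`-valued coefficient family `Option.elim β₀ β`, the
  `Option`-indexed sum split by `Fintype.sum_option`).
* `baker_linearIndependent_one_ofReal_log` — Theorem 2.1 at REAL logarithms: for positive real
  algebraic `aᵢ` whose real logarithms are `ℚ`-linearly independent, the complex family
  `1, ↑(log a₁), ↑(log a₂), …` is linearly independent over `ℚ̄` (`e^{↑(log aᵢ)} = ↑aᵢ` by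
  `Complex.ofReal_exp`, `Real.exp_log`; `ℚ`-independence transports along the injective `ℚ`-linear
  map `ℝ → ℂ`, `LinearIndependent.map'`).
* `baker_real_log_coeff_eq_zero` — the REAL coefficient form: `r + Σᵢ cᵢ log aᵢ = 0` with real
  algebraic `r, cᵢ` and `aᵢ` as above forces `r = 0` and every `cᵢ = 0`. This is the shape met by
  period computations over `ℝ` (values `r + Σ cᵢ log aᵢ` of one-dimensional rational integrals,
  Kontsevich–Zagier 2001, §1.2) and by class-number and regulator arguments.

Nothing here weakens or restates `baker`; no definitions are introduced. The homogeneous complex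
form (drop `β₀`) is `RoyWaldschmidt1997.eq_zero_of_sum_algebraic_mul_eq_zero`
(`QuadraticRelationsLogarithmsBakerProofs.lean`).

## References

* [Baker1975] A. Baker, *Transcendental Number Theory*, Cambridge Univ. Press, 1975, Ch. 2,
  Theorem 2.1 (p. 17).
-/

noncomputable section

open Complex

namespace Literature.NumberTheory.Transcendental

/-- **Baker's Theorem 2.1, coefficient form.** If `lᵢ ∈ ℂ` (`i` in a finite index type) have
`e^{lᵢ}` algebraic and are linearly independent over `ℚ`, and `β₀ + Σᵢ βᵢ lᵢ = 0` with ALGEBRAIC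
`β₀, βᵢ ∈ ℂ`, then `β₀ = 0` and every `βᵢ = 0`. This is `baker_holds` (`1, l₁, l₂, …` linearly
independent over `ℚ̄ = algebraicClosure ℚ ℂ`) unfolded by `Fintype.linearIndependent_iff` at the
coefficient family `Option.elim β₀ β : Option ι → ℚ̄`. [cite: Baker1975, Theorem 2.1] -/
theorem baker_coeff_eq_zero {ι : Type*} [Fintype ι] (l : ι → ℂ)
    (halg : ∀ i, IsAlgebraic ℚ (cexp (l i))) (hli : LinearIndependent ℚ l)
    {β₀ : ℂ} {β : ι → ℂ} (hβ₀ : IsAlgebraic ℚ β₀) (hβ : ∀ i, IsAlgebraic ℚ (β i))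
    (h : β₀ + ∑ i, β i * l i = 0) : β₀ = 0 ∧ ∀ i, β i = 0 := by
  have hB := baker_holds l halg hli
  -- the coefficients, as elements of `ℚ̄ = algebraicClosure ℚ ℂ`
  let g : Option ι → algebraicClosure ℚ ℂ := fun o =>
    o.elim ⟨β₀, mem_algebraicClosure_iff.2 hβ₀⟩ fun i => ⟨β i, mem_algebraicClosure_iff.2 (hβ i)⟩
  have hg : ∑ o, g o • (o.elim (1 : ℂ) l) = 0 := by
    rw [Fintype.sum_option]
    simpa [g, IntermediateField.smul_def, smul_eq_mul] using h
  have h0 := Fintype.linearIndependent_iff.mp hB g hg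
  exact ⟨by simpa [g] using congrArg Subtype.val (h0 none),
    fun i => by simpa [g] using congrArg Subtype.val (h0 (some i))⟩

/-- **Baker's Theorem 2.1 at real logarithms.** If `aᵢ > 0` are real algebraic numbers whose real
logarithms `log aᵢ` are linearly independent over `ℚ`, then the complex numbers
`1, ↑(log a₁), ↑(log a₂), …` (indexed by `Option ι`, `none ↦ 1`) are linearly independent over the
field `ℚ̄ = algebraicClosure ℚ ℂ` of all algebraic numbers: `e^{↑(log aᵢ)} = ↑aᵢ` is algebraic and
`ℚ`-independence transports along the injective `ℚ`-linear map `ℝ → ℂ`.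
[cite: Baker1975, Theorem 2.1] -/
theorem baker_linearIndependent_one_ofReal_log {ι : Type*} (a : ι → ℝ) (ha : ∀ i, 0 < a i)
    (halg : ∀ i, IsAlgebraic ℚ (a i)) (hli : LinearIndependent ℚ fun i => Real.log (a i)) :
    LinearIndependent (algebraicClosure ℚ ℂ)
      fun o : Option ι => o.elim (1 : ℂ) fun i => ((Real.log (a i) : ℝ) : ℂ) := by
  refine baker_holds _ (fun i => ?_) ?_
  · -- `e^{log aᵢ} = aᵢ` is algebraic
    rw [← Complex.ofReal_exp, Real.exp_log (ha i)]
    exact (halg i).algebraMap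
  · -- `ℝ → ℂ` is an injective `ℚ`-linear map
    exact hli.map' (Complex.ofRealAm.toLinearMap.restrictScalars ℚ)
      (LinearMap.ker_eq_bot.2 Complex.ofReal_injective)

/-- **Baker's Theorem 2.1, real coefficient form.** If `aᵢ > 0` (`i` in a finite index type) are
real algebraic numbers with `ℚ`-linearly independent logarithms and `r + Σᵢ cᵢ log aᵢ = 0` with real
ALGEBRAIC `r, cᵢ`, then `r = 0` and every `cᵢ = 0`: the relation, read in `ℂ` with its coefficients in
`ℚ̄`, is a finite relation against the `ℚ̄`-linearly independent family `1, ↑(log aᵢ)`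
(`baker_linearIndependent_one_ofReal_log`). [cite: Baker1975, Theorem 2.1] -/
theorem baker_real_log_coeff_eq_zero {ι : Type*} [Fintype ι] (a : ι → ℝ) (ha : ∀ i, 0 < a i)
    (halg : ∀ i, IsAlgebraic ℚ (a i)) (hli : LinearIndependent ℚ fun i => Real.log (a i))
    {r : ℝ} {c : ι → ℝ} (hr : IsAlgebraic ℚ r) (hc : ∀ i, IsAlgebraic ℚ (c i))
    (h : r + ∑ i, c i * Real.log (a i) = 0) : r = 0 ∧ ∀ i, c i = 0 := by
  have hB := baker_linearIndependent_one_ofReal_log a ha halg hli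
  -- real algebraic numbers, complexified, are elements of `ℚ̄ ⊂ ℂ`
  have hmem : ∀ x : ℝ, IsAlgebraic ℚ x → (x : ℂ) ∈ algebraicClosure ℚ ℂ := fun x hx =>
    mem_algebraicClosure_iff.2 hx.algebraMap
  let g : Option ι → algebraicClosure ℚ ℂ := fun o =>
    o.elim ⟨(r : ℂ), hmem r hr⟩ fun i => ⟨(c i : ℂ), hmem (c i) (hc i)⟩
  -- the relation, read in `ℂ`
  have hC : (r : ℂ) + ∑ i, (c i : ℂ) * ((Real.log (a i) : ℝ) : ℂ) = 0 := by exact_mod_cast h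
  have hg : ∑ o, g o • (o.elim (1 : ℂ) fun i => ((Real.log (a i) : ℝ) : ℂ)) = 0 := by
    rw [Fintype.sum_option]
    simpa [g, IntermediateField.smul_def, smul_eq_mul] using hC
  have h0 := Fintype.linearIndependent_iff.mp hB g hg
  exact ⟨Complex.ofReal_eq_zero.1 (by simpa [g] using congrArg Subtype.val (h0 none)),
    fun i => Complex.ofReal_eq_zero.1 (by simpa [g] using congrArg Subtype.val (h0 (some i)))⟩

end Literature.NumberTheory.Transcendental
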